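import Summits.QuantumFields.YangMills.Theorems.UnitScaleTiltProp7LineAvgSmoothRightInverse
import Summits.QuantumFields.YangMills.Theorems.UnitScaleTiltProp7LineAvgRightInversePi
import Summits.QuantumFields.YangMills.Theorems.UnitScaleTiltProp7LineAvgAdjoint
import HarnessLib

/-!
# Route `UnitScaleTilt`, crux K1 child «MinimiserStabilityRegPr» (stmt-QuantumFields-19200), registered stub `stub_prop7From14` (leaf V3 «Prop 7 from a
# background (14)») — sub-lemma V3-C″, vector-valued form: THE SMOOTH RIGHT INVERSE OF `Q_k` ON `(ι → ℝ)`-VALUED BOND FIELDS (coordinatewise), with the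
# sup ∕ `ℓ²` ∕ gradient-sup ∕ gradient-`ℓ²` bounds; instance at the d = 3 carrier

Cell `ym3-torus` ∕ fleet seat `ym-ust-19200-p1` (gen 4).  The fields of [Balaban1985Variational] Sect. C are `𝔤`-valued; the scalar smooth right inverse
of `UnitScaleTiltProp7LineAvgSmoothRightInverse` (this seat) applied coordinate by coordinate (pattern of gen 3's `UnitScaleTiltProp7LineAvgRightInversePi`)
gives a linear right inverse of `Q_k = LatticeFieldCalculus.bondAvgIter k` on `(ι → ℝ)`-valued bond fields with BOTH bounds of (46): coordinate sup bound
`3·2^{d−1}`, coordinate-sum `ℓ²` bound `18·4^{d−1}L^{kd}`, coordinate gradient-sup bound `90·2^{d−1}L^{−k}`, coordinate-sum gradient-`ℓ²` bound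
`8100·d·4^{d−1}L^{kd}L^{−2k}`, constants independent of `k`, of the volume and of `ι` (§1); and (§2) the coordinatewise forms of the transpose identity
and multiplier bound of `UnitScaleTiltProp7LineAvgAdjoint` for `(ι → ℝ)`-valued multipliers (`𝔤`-valued currents `J = M_k^⊤μ` read in real coordinates):
`Σ_bΣ_i A_i(b)Y_i(b) = Σ_cΣ_i μ_i(c)(Q_kY_i)(c)` and `|μ_i(c)| ≤ L^{kd}·max_{b,i}|A_i(b)|`.  Sorry-free, no definition; nothing of Bałaban's is asserted.

References: T. Bałaban, CMP 102 (1985) 277–309 [Balaban1985Variational] ((45)–(47) p.285).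
-/

noncomputable section

open scoped BigOperators

namespace Summit.QuantumFields.YangMills.Theorems.Prop7LineAvgSmoothRightInverse

open Literature.MathematicalPhysics.QuantumFieldTheory.Balaban1983to89
open Finset LatticeFieldCalculus B1RG242Torus
open Summit.QuantumFields.YangMills.Theorems.Prop7LineAvgRightInverse (bondAvgIter_apply_pi)

variable {P : Params} {k : ℕ} {ι : Type*} [Fintype ι]

/-- **THE SMOOTH RIGHT INVERSE OF `Q_k` ON VECTOR-VALUED BOND FIELDS** (coordinatewise application of `exists_smoothRightInverse_bondAvgIter`): linear `H`
with `Q_k(HZ) = Z`, the sup and gradient-sup bounds per coordinate, the `ℓ²` and gradient-`ℓ²` bounds on coordinate sums; `k` in the standing range.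
[cite: Balaban1985Variational, (45)-(46) p.285] -/
theorem exists_smoothRightInverse_bondAvgIter_pi (hk : k ≤ P.m + P.K) :
    ∃ H : (PBond P k → ι → ℝ) →ₗ[ℝ] (PBond P 0 → ι → ℝ), ∀ Z : VecField P k (ι → ℝ),
      bondAvgIter k (H Z) = Z ∧
      (∀ B : ℝ, (∀ (c : PBond P k) (i : ι), |Z c i| ≤ B) → ∀ (b : PBond P 0) (i : ι), |H Z b i| ≤ 3 * 2 ^ (P.d - 1) * B) ∧
      (∑ b : PBond P 0, ∑ i, (H Z b i) ^ 2 ≤ 18 * 4 ^ (P.d - 1) * ((P.L : ℝ) ^ k) ^ P.d * ∑ c : PBond P k, ∑ i, (Z c i) ^ 2) ∧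
      (∀ B : ℝ, (∀ (c : PBond P k) (i : ι), |Z c i| ≤ B) → ∀ (b : PBond P 0) (ρ : Fin P.d) (i : ι),
        |H Z ⟨b.src.shift ρ, b.dir⟩ i - H Z b i| ≤ 90 * 2 ^ (P.d - 1) * ((P.L : ℝ) ^ k)⁻¹ * B) ∧
      (∑ b : PBond P 0, ∑ ρ : Fin P.d, ∑ i, (H Z ⟨b.src.shift ρ, b.dir⟩ i - H Z b i) ^ 2
        ≤ 8100 * P.d * 4 ^ (P.d - 1) * ((P.L : ℝ) ^ k) ^ P.d * (((P.L : ℝ) ^ k) ^ 2)⁻¹ * ∑ c : PBond P k, ∑ i, (Z c i) ^ 2) := by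
  obtain ⟨H, hH⟩ := exists_smoothRightInverse_bondAvgIter (P := P) hk
  let Hpi : (PBond P k → ι → ℝ) →ₗ[ℝ] (PBond P 0 → ι → ℝ) :=
    { toFun := fun Z b i => H (fun c => Z c i) b
      map_add' := fun Z Z' => by
        funext b i
        have h1 : (fun c => (Z + Z') c i) = (fun c => Z c i) + fun c => Z' c i := rfl
        show H (fun c => (Z + Z') c i) b = H (fun c => Z c i) b + H (fun c => Z' c i) b
        rw [h1, map_add]
        rfl
      map_smul' := fun a Z => by
        funext b i
        have h1 : (fun c => (a • Z) c i) = a • fun c => Z c i := rfl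
        show H (fun c => (a • Z) c i) b = a • H (fun c => Z c i) b
        rw [h1, map_smul]
        rfl }
  refine ⟨Hpi, fun Z => ⟨?_, fun B hB b i => ?_, ?_, fun B hB b ρ i => ?_, ?_⟩⟩
  · funext c i
    rw [bondAvgIter_apply_pi hk]
    exact congrFun (hH (fun c' => Z c' i)).1 c
  · exact (hH (fun c => Z c i)).2.1 B (fun c => hB c i) b
  · have hr : ∑ c : PBond P k, ∑ i, (Z c i) ^ 2 = ∑ i, ∑ c : PBond P k, (Z c i) ^ 2 := Finset.sum_comm
    rw [Finset.sum_comm, hr, Finset.mul_sum]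
    refine Finset.sum_le_sum fun i _ => ?_
    exact (hH (fun c => Z c i)).2.2.1
  · exact (hH (fun c => Z c i)).2.2.2.1 B (fun c => hB c i) b ρ
  · have hr : ∑ c : PBond P k, ∑ i, (Z c i) ^ 2 = ∑ i, ∑ c : PBond P k, (Z c i) ^ 2 := Finset.sum_comm
    have hl : ∑ b : PBond P 0, ∑ ρ : Fin P.d, ∑ i, (Hpi Z ⟨b.src.shift ρ, b.dir⟩ i - Hpi Z b i) ^ 2
        = ∑ i, ∑ b : PBond P 0, ∑ ρ : Fin P.d, (Hpi Z ⟨b.src.shift ρ, b.dir⟩ i - Hpi Z b i) ^ 2 := by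
      calc ∑ b : PBond P 0, ∑ ρ : Fin P.d, ∑ i, (Hpi Z ⟨b.src.shift ρ, b.dir⟩ i - Hpi Z b i) ^ 2
          = ∑ b : PBond P 0, ∑ i, ∑ ρ : Fin P.d, (Hpi Z ⟨b.src.shift ρ, b.dir⟩ i - Hpi Z b i) ^ 2 :=
            Finset.sum_congr rfl fun b _ => Finset.sum_comm
        _ = ∑ i, ∑ b : PBond P 0, ∑ ρ : Fin P.d, (Hpi Z ⟨b.src.shift ρ, b.dir⟩ i - Hpi Z b i) ^ 2 := Finset.sum_comm
    rw [hl, hr, Finset.mul_sum]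
    refine Finset.sum_le_sum fun i _ => ?_
    exact (hH (fun c => Z c i)).2.2.2.2

/-- **AT THE d = 3 CARRIER** (`Site (F.P K) 0`, `k = K − n`): the vector-valued smooth right inverse of `Q_{K−n}` with constants `12`, `288L^{3(K−n)}`,
`360L^{−(K−n)}`, `388800L^{3(K−n)}L^{−2(K−n)}`, uniformly in `m`, `n`, `K`, `ι`. [cite: Balaban1985Variational, (45)-(46) p.285] -/
theorem exists_smoothRightInverse_bondAvgIter_pi_T3 (F : T3ContinuumYM3Torus.T3Family) (n K : ℕ) :
    ∃ H : (PBond (F.P K) (K - n) → ι → ℝ) →ₗ[ℝ] (PBond (F.P K) 0 → ι → ℝ), ∀ Z : VecField (F.P K) (K - n) (ι → ℝ),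
      bondAvgIter (K - n) (H Z) = Z ∧
      (∀ B : ℝ, (∀ (c : PBond (F.P K) (K - n)) (i : ι), |Z c i| ≤ B) → ∀ (b : PBond (F.P K) 0) (i : ι), |H Z b i| ≤ 12 * B) ∧
      (∑ b : PBond (F.P K) 0, ∑ i, (H Z b i) ^ 2 ≤ 288 * ((F.L : ℝ) ^ (K - n)) ^ 3 * ∑ c : PBond (F.P K) (K - n), ∑ i, (Z c i) ^ 2) ∧
      (∀ B : ℝ, (∀ (c : PBond (F.P K) (K - n)) (i : ι), |Z c i| ≤ B) → ∀ (b : PBond (F.P K) 0) (ρ : Fin 3) (i : ι),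
        |H Z ⟨b.src.shift ρ, b.dir⟩ i - H Z b i| ≤ 360 * ((F.L : ℝ) ^ (K - n))⁻¹ * B) ∧
      (∑ b : PBond (F.P K) 0, ∑ ρ : Fin 3, ∑ i, (H Z ⟨b.src.shift ρ, b.dir⟩ i - H Z b i) ^ 2
        ≤ 388800 * ((F.L : ℝ) ^ (K - n)) ^ 3 * (((F.L : ℝ) ^ (K - n)) ^ 2)⁻¹ * ∑ c : PBond (F.P K) (K - n), ∑ i, (Z c i) ^ 2) := by
  obtain ⟨H, hH⟩ := exists_smoothRightInverse_bondAvgIter_pi (P := F.P K) (k := K - n) (ι := ι) (show K - n ≤ F.m + K by omega)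
  refine ⟨H, fun Z => ⟨(hH Z).1, fun B hZ b i => ?_, ?_, fun B hZ b ρ i => ?_, ?_⟩⟩
  · have := (hH Z).2.1 B hZ b i; norm_num at this ⊢; exact this
  · have := (hH Z).2.2.1; norm_num at this ⊢; exact this
  · have := (hH Z).2.2.2.1 B hZ b ρ i; norm_num at this ⊢; exact this
  · have := (hH Z).2.2.2.2; norm_num at this ⊢; exact this

/-! ## §2 Transpose identity and multiplier bound, coordinatewise -/

section TransposePi

variable (h : P.sitesPerDir 0 = P.L ^ k * P.sitesPerDir k)
variable (μc : PBond P k → ι → ℝ) (A : PBond P 0 → ι → ℝ)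
  (hA : ∀ (b : PBond P 0) (i : ι), A b i = (((P.L : ℝ) ^ k) ^ P.d * (P.L : ℝ) ^ k)⁻¹ *
    (((((b.src b.dir).val % P.L ^ k : ℕ) : ℝ) + 1) * μc ⟨Site.proj k k b.src, b.dir⟩ i
      + ((P.L ^ k - 1 - (b.src b.dir).val % P.L ^ k : ℕ) : ℝ) * μc ⟨(Site.proj k k b.src).unshift b.dir, b.dir⟩ i))
include h hA

/-- **TRANSPOSE IDENTITY, COORDINATEWISE**: `Σ_b Σ_i A_i(b)·Y_i(b) = Σ_c Σ_i μ_i(c)·(Q_kY)_i(c)` for `(ι → ℝ)`-valued multipliers and fields, `A` the tent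
field of `μ` coordinate by coordinate (`= M_k^⊤μ`), `Q_k = bondAvgIter k`, `k` in the standing range. [cite: Balaban1984PropagatorsI, (1.18) p.20] -/
theorem sum_adjField_mul_eq_bondAvgIter_pi (hk : k ≤ P.m + P.K) (Y : VecField P 0 (ι → ℝ)) :
    ∑ b : PBond P 0, ∑ i, A b i * Y b i = ∑ c : PBond P k, ∑ i, μc c i * bondAvgIter k Y c i := by
  rw [Finset.sum_comm, Finset.sum_comm (s := (univ : Finset (PBond P k)))]
  refine Finset.sum_congr rfl fun i _ => ?_
  rw [Prop7LineAvgAdjoint.sum_adjField_mul_eq_bondAvgIter h (fun c => μc c i) (fun b => A b i) (fun b => hA b i) hk (fun b => Y b i)]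
  exact Finset.sum_congr rfl fun c _ => by rw [bondAvgIter_apply_pi hk]

omit [Fintype ι] in
/-- **MULTIPLIER BOUND, COORDINATEWISE**: `|μ_i(c)| ≤ L^{kd}·B` whenever `|A_i(b)| ≤ B` for all fine bonds `b` and coordinates `i`. [folklore] -/
theorem abs_le_pow_mul_of_adjField_abs_le_pi {B : ℝ} (hB : ∀ (b : PBond P 0) (i : ι), |A b i| ≤ B) (c : PBond P k) (i : ι) :
    |μc c i| ≤ ((P.L : ℝ) ^ k) ^ P.d * B :=
  Prop7LineAvgAdjoint.abs_le_pow_mul_of_adjField_abs_le h (fun c => μc c i) (fun b => A b i) (fun b => hA b i) (fun b => hB b i) c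

/-- **THE LINEAR-TERM ESTIMATE, COORDINATEWISE**: `|Σ_bΣ_i A_i(b)Y_i(b)| ≤ L^{kd}·B·Σ_cΣ_i|(Q_kY)_i(c)|`. [cite: Balaban1985Variational, (152) p.300] -/
theorem abs_sum_adjField_mul_le_bondAvgIter_pi (hk : k ≤ P.m + P.K) {B : ℝ} (hB : ∀ (b : PBond P 0) (i : ι), |A b i| ≤ B) (Y : VecField P 0 (ι → ℝ)) :
    |∑ b : PBond P 0, ∑ i, A b i * Y b i| ≤ ((P.L : ℝ) ^ k) ^ P.d * B * ∑ c : PBond P k, ∑ i, |bondAvgIter k Y c i| := by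
  rw [sum_adjField_mul_eq_bondAvgIter_pi h μc A hA hk Y, Finset.mul_sum]
  refine (Finset.abs_sum_le_sum_abs _ _).trans (Finset.sum_le_sum fun c _ => ?_)
  rw [Finset.mul_sum]
  refine (Finset.abs_sum_le_sum_abs _ _).trans (Finset.sum_le_sum fun i _ => ?_)
  rw [abs_mul]
  exact mul_le_mul_of_nonneg_right (abs_le_pow_mul_of_adjField_abs_le_pi h μc A hA hB c i) (abs_nonneg _)

end TransposePi

end Summit.QuantumFields.YangMills.Theorems.Prop7LineAvgSmoothRightInverse

end
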